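import Summits.QuantumFields.QCD.Theses.NestedDissectionSea
import Literature.MathematicalPhysics.QuantumLattice.WilsonPositivityDomain

/-!
# Crux `NegativeCellsDilute` (stmt-QuantumFields-13900), negative side — the pin window

Support file of the standing disprover (refuter-cdisprove-stmt-QuantumFields-13900-0). The crux is
`∀ Nf ∈ {2,3} ∃ reg (HasMassScaling, HasAsymptoticScaling) ∃ M₀ b₀ ℓ ∀ m > M₀ ∃ R, (a) windowed
dilution of sign defects ∧ (b) parity pin`; the witness datum `reg.mcrit` is free. Proved here
(sorry-free, standard axioms):

* input (tree): Seiler's positivity domain `fermionDet_wilsonDirac_re_pos` —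
  `Re det D_W(U, m, 1) > 0` for `m > 0`, every gauge field, every torus;
* hence the pin integrand vanishes at positive probe mass (`not_pin_at`) and clause (b), inlined
  verbatim, forces `mcrit k − a_k M/Z_m k ≤ 0` for all `M > M₀` eventually in `k` (`pin_window`,
  `pin_window_of_crux`): the junk witnesses `mcrit ≡ c > 0`, `mcrit → +∞` are dead,
  `limsup_k mcrit_k Z_m(k)/a_k ≤ M₀`. (The mirror side `m < −8 ⇒ Re det > 0`, hence
  `mcrit k − a_k M/Z_m k ≥ −8`, is `CoerciveSeaNegative.fermionDet_wilsonDirac_re_pos_of_pos_or_lt`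
  in `Theorems/CoerciveSea/Negative/SeilerBothSides.lean`, landed by the hinge crux's disprover.)

Companion: `CellPositivity.lean` (the pin-less crux is trivially true).
-/

noncomputable section

namespace Summit.QuantumFields.QCD.Theorems.NegativeCellsDilutePinWindow


open MeasureTheory Filter Matrix
open Literature.MathematicalPhysics.QuantumLattice Literature.MathematicalPhysics.QuantumFieldTheory
  Literature.Probability.LatticeModels

/-! ## The pin window: the pin event is empty at positive probe mass (Seiler positivity) -/

/-! ### The pin ratio vanishes at positive probe mass -/

/-- At positive probe mass the pin event `Re det D_W(U, μ, 1) < 0` is EMPTY, so its phase-quenched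
ratio is `0` for every torus, coupling and weight, and the pin inequality `1/4 ≤ P` fails
deterministically. [folklore] -/
theorem not_pin_at {N : ℕ} [NeZero N] (β : ℝ) {μ : ℝ} (hμ : 0 < μ)
    (wt : GaugeConfig 4 N (Matrix.specialUnitaryGroup (Fin 3) ℂ) → ℝ) :
    ¬ ((1 / 4 : ℝ) ≤ (∫ U, (if (fermionDet (wilsonDirac (fundamentalRep (Fin 3)) U μ 1)).re < 0
        then (1 : ℝ) else 0) * wt U
          ∂(wilsonMeasure (d := 4) (L := N) (fundamentalRep (Fin 3)) β)) /
      (∫ U, wt U ∂(wilsonMeasure (d := 4) (L := N) (fundamentalRep (Fin 3)) β))) := by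
  have h0 : ∀ U : GaugeConfig 4 N (Matrix.specialUnitaryGroup (Fin 3) ℂ),
      (if (fermionDet (wilsonDirac (fundamentalRep (Fin 3)) U μ 1)).re < 0 then (1 : ℝ) else 0) = 0 := by
    intro U
    rw [if_neg]
    exact not_lt.mpr (fermionDet_wilsonDirac_re_pos _ (fun g => fundamentalRep_mem_unitaryGroup g) U hμ).le
  simp only [h0, zero_mul, integral_zero, zero_div]
  norm_num

/-! ### The window clause (b) forces on `reg.mcrit` -/

/-- Every torus size beyond `R / a_k` is admissible: clause (b) is never vacuous in `S`. [folklore] -/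
theorem exists_admissible_S {Nf : ℕ} (reg : QCDRegularisation Nf) (R : ℝ) (k : ℕ) :
    ∃ S : ℕ, R ≤ reg.a k * (2 * S + 1) := by
  have ha := reg.a_pos k
  refine ⟨⌈R / reg.a k⌉₊, ?_⟩
  have h1 : R / reg.a k ≤ (⌈R / reg.a k⌉₊ : ℝ) := Nat.le_ceil _
  have h2 : R ≤ reg.a k * (⌈R / reg.a k⌉₊ : ℝ) := by
    rw [div_le_iff₀ ha] at h1; linarith
  nlinarith

/-- **Pin window (upper side).** If clause (b) of `NegativeCellsDilute` (inlined VERBATIM as the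
hypothesis) holds for `reg`, `m`, `M₀`, `R`, then for every `M > M₀`, eventually in `k`, the probe
mass `mcrit k − a_k M / Z_m k` is `≤ 0`: the pin pins the free witness datum `reg.mcrit` from above
(`limsup_k mcrit_k Z_m(k)/a_k ≤ M₀`); the junk witnesses `mcrit ≡ c > 0`, `mcrit → +∞` fail (b)
deterministically. [folklore] -/
theorem pin_window {Nf : ℕ} {reg : QCDRegularisation Nf} {m : Fin Nf → ℝ} {M₀ R : ℝ}
    (h : ∀ M : ℝ, M₀ < M → ∀ᶠ k : ℕ in Filter.atTop, ∀ S : ℕ, R ≤ reg.a k * (2 * S + 1) →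
      let N : ℕ := 2 * S + 1
      let mq : Fin Nf → ℝ := fun f => reg.mcrit k + reg.a k * m f / reg.Zm k
      let wt : GaugeConfig 4 N (Matrix.specialUnitaryGroup (Fin 3) ℂ) → ℝ :=
        fun U => ∏ f, ‖fermionDet (wilsonDirac (fundamentalRep (Fin 3)) U (mq f) 1)‖
      (1 / 4 : ℝ) ≤ (∫ U, (if (fermionDet (wilsonDirac (fundamentalRep (Fin 3)) U
          (reg.mcrit k - reg.a k * M / reg.Zm k) 1)).re < 0 then (1 : ℝ) else 0) * wt U
            ∂(wilsonMeasure (d := 4) (L := N) (fundamentalRep (Fin 3)) (reg.β k))) /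
        (∫ U, wt U ∂(wilsonMeasure (d := 4) (L := N) (fundamentalRep (Fin 3)) (reg.β k))))
    {M : ℝ} (hM : M₀ < M) :
    ∀ᶠ k : ℕ in Filter.atTop, reg.mcrit k - reg.a k * M / reg.Zm k ≤ 0 := by
  filter_upwards [h M hM] with k hk
  obtain ⟨S, hS⟩ := exists_admissible_S reg R k
  have hkS := hk S hS
  by_contra hcon
  exact not_pin_at (reg.β k) (lt_of_not_ge hcon) _ hkS

/-- The crux hands its clause (b) to `pin_window` (projection; certifies the inlined text is
verbatim): any witness `reg` of `NegativeCellsDilute` has its `mcrit` in the pin window. [folklore] -/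
theorem pin_window_of_crux (h : Theses.NestedDissectionSea.NegativeCellsDilute) :
    ∀ Nf : ℕ, (Nf = 2 ∨ Nf = 3) → ∃ reg : QCDRegularisation Nf, reg.HasMassScaling ∧ ∃ M₀ : ℝ,
      0 ≤ M₀ ∧ ∀ m : Fin Nf → ℝ, (∀ f, M₀ < m f) → ∀ M : ℝ, M₀ < M → ∀ᶠ k : ℕ in Filter.atTop,
        reg.mcrit k - reg.a k * M / reg.Zm k ≤ 0 := by
  intro Nf hNf
  obtain ⟨reg, hms, -, M₀, hM₀, b₀, -, ℓ, -, h⟩ := h Nf hNf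
  refine ⟨reg, hms, M₀, hM₀, fun m hm M hM => ?_⟩
  obtain ⟨R, -, -, hb⟩ := h m hm
  exact pin_window hb hM

end Summit.QuantumFields.QCD.Theorems.NegativeCellsDilutePinWindow

end
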